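import Summits.QuantumFields.YangMills.Theorems.UnitScaleTiltProp7CornerCombChainPerCornerOfStepMean
import Summits.QuantumFields.YangMills.Theorems.UnitScaleTiltProp7CornerCombCellRows
import Summits.QuantumFields.YangMills.Theorems.UnitScaleTiltProp7CornerCombCellKnitAbstract
import HarnessLib

/-!
# Route `UnitScaleTilt`, crux K1 «MinimiserStabilityRegPr» (stmt-QuantumFields-19200), route-R E′ (A′)-on-Σ, P-A2 (β), row «(n3)-comb» `hMcomb` —
# lane (II) file F-6d-3 «Σ OVER CORNERS: THE COVARIANT GRADIENT ENERGY OF THE ACCUMULATED COMB GAUGE FUNCTION OVER ONE PERIOD CELL»: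
# `Σ_{z ∈ cell_{k′+1}} Σ_κ ‖Λ_{k′+1}(z) − Ad_{V̄_{k′}(L•z,κ)} Λ_{k′+1}(z + e_κ)‖² ≤ 3·( top_{k′}[L·GRAD, d·MASS] + 2d·c_L·Σ_{j<k′} w_j·[d²Aᵈ·GRAD_j, d²Aᵈ·MASS_j, d·DEF_j]×2 + 2c_L·Σ_{i≤k′}(√L)^{k′−i}·[d·GRAD_i, d·MASS_i]×2 )`

Cell `ym3-torus` (HUMAN RULING D-0037: YM₃ on the torus is ladder rung R3 — not d = 4, not a mass gap, not Clay), D-0154 (3c) R3 twin-width seat `ym-routeR-w6` (gen 9);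
★routeR-w1 g9 PENS ROUND 4 (2026-08-29 08:50:39Z) «F-6d Σ OVER CORNERS + MULTIPLICITIES + TRANSFER KNIT → routeR-w6» — OUTPUT ★★★`sum_cell_normSq_covGrad_gauge_le`.
`--supports stmt-QuantumFields-19200 --as helper`; THEOREMS ONLY (0 `def`, 0 `sorry`); count-neutral.  «(O2) groundwork — route-internal row (n3)-comb, NOT N06, NOT a print row; OPEN».
Nothing of `hMcomb`, `hMcomb₂`, (β), `hPA2`, `hcoS`, E′, EX, the stub, the crux, d = 4 or the gap is claimed.

THE POINT.  w3-19200 g13's per-corner row ✓F-6c-3d `normSq_covGrad_gauge_le_of_stepMean` (= ✓F-6c-3a ∘ 3b ∘ 3c ∘ ★routeR-w1 ✓F-6c-2b) at every corner `z = boxVec N′ z₀` of the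
level-`(k′+1)` period cell, summed over `z₀, κ` by the abstract knit ✓F-6d-2b `sum_sum_linForm_le`, the twelve atom totals discharged by ✓F-6d-2a∕✓F-6d-1: the top pair counts `L`
(double block) and `d` (shifted block), every cube of side `n+1 ≤ A·L²` at the level-`j` corner chain (`j < k′`, spacing `L^{k′+1−j} ≥ L²`) counts `≤ Aᵈ` times, every block of side `L`
below the top counts once, and the neighbour `z + e_κ` costs exactly what `z` does (periodicity, ✓F-6d-1 §1).  The torus∕tower TRANSFER (`GRADcell_j ≲ L^{(4−d)j}·GRAD₀`, ★routeR-w4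
F-7b) and Weitzenböck are NOT here (F-7c∕F-8).

WHAT IS PROVED (ns `…Theorems.Prop7CornerCombCellKnit`; `Matrix (Fin N) (Fin N) ℂ`, every `d`, `L ≥ 2`).
* §1 `hol_add_of_periodic` (transport of a `v`-periodic configuration from `x + v` = from `x`), `defDensity_periodic` (the straight-step defect density of level `j+1` is `N_{j+1}`-periodic).
* §2 ★★★ `sum_cell_normSq_covGrad_gauge_le` — the title; hypotheses = F-6c-3d's tower data with the top windows `hw`∕`hbU` at every cell corner, the cube budget `n+1 ≤ A·L²`, the
  level periods `Nc i = N′·L^{k′+1−i}` and `Nc i`-periodicity of `V i`, `G i` (`i ≤ k′`); conclusion in the cell functionals `GRADcell_i` (component outside, direction inside — ★routeR-w4 F-7b's letter), `MASScell_i`, `DEFcell_j` written out.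
HONEST SCOPE.  A knit by name; no estimate beyond the cited tree theorems; constants closed in `(d, L, N, n, A)` and the level weights.  Rung R3, not Clay; YM gap NOT proved.

References: T. Bałaban, CMP **98** (1985) 17–51 [Balaban1985Averaging] ((2) p.17, (42)–(47) pp.23–25, (112) p.34, (125)–(126) p.36); CMP **95** (1984) 17–40 [Balaban1984PropagatorsI]
((1.18)–(1.20) pp.19–20); CMP **109** (1987) 249–301 [Balaban1987RG1] ((0.1) p.251); [Balaban1983RegularityDecay] ((2.27) p.580).
-/

set_option autoImplicit false

noncomputable section

open scoped BigOperators Matrix.Norms.L2Operator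

namespace Summit.QuantumFields.YangMills.Theorems.Prop7CornerCombCellKnit

open Finset
open Literature.MathematicalPhysics.QuantumFieldTheory.Balaban1983to89
open B7Prop1Explicit (Site Letter e hol seg treeWord boxVec plaqWord U1 Wcx bavg stepHol hol_cons)
open B7Eq78Linearization (conjR)
open B7Prop3GeneralLinear (FhatCov)
open Summit.QuantumFields.YangMills.Theorems.Prop7CornerCombChainPerCornerOfStepMean (normSq_covGrad_gauge_le_of_stepMean)
open Summit.QuantumFields.YangMills.Theorems.Prop7CornerCombCellRows
open Summit.QuantumFields.YangMills.Theorems.Prop7CornerCombCellKnitAbstract (sum_sum_linForm_le)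

variable {d : ℕ}

/-! ## §1 Periodicity helpers -/

/-- Transport of a `v`-periodic configuration along any word from `x + v` equals the transport from `x`. [cite: Balaban1987RG1, (0.1) p.251] -/
theorem hol_add_of_periodic {G : Type*} [Group G] (V : Site d → Fin d → G) (v : Site d) (hV : ∀ (x : Site d) (μ : Fin d), V (x + v) μ = V x μ) :
    ∀ (w : List (Letter d)) (x : Site d), hol V (x + v) w = hol V x w
  | [], x => by simp
  | l :: w, x => by
    rw [hol_cons, hol_cons, add_right_comm, hol_add_of_periodic V v hV w (x + l.vec)]
    congr 1
    simp only [stepHol]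
    split_ifs
    · exact hV _ _
    · rw [add_right_comm, hV]

variable {N : ℕ}

/-- **THE STRAIGHT-STEP DEFECT DENSITY OF LEVEL `j+1` IS `T′`-PERIODIC** when `G (j+1)` is `T′`-periodic and `V j`, `G j` are `T = L·T′`-periodic (the block maps commute with
translations by block multiples). [cite: Balaban1985Averaging, (42)-(43) pp.23-24; Balaban1987RG1, (0.1) p.251] -/
theorem defDensity_periodic (L T T' : ℕ) (hT : T = L * T') (Vj : Site d → Fin d → (Matrix (Fin N) (Fin N) ℂ)ˣ) (Gj Gj1 : Site d → Fin d → Matrix (Fin N) (Fin N) ℂ)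
    (hVj : ∀ (x : Site d) (μ ι : Fin d), Vj (x + (T : ℤ) • e ι) μ = Vj x μ) (hGj : ∀ (x : Site d) (μ ι : Fin d), Gj (x + (T : ℤ) • e ι) μ = Gj x μ)
    (hGj1 : ∀ (x : Site d) (μ ι : Fin d), Gj1 (x + (T' : ℤ) • e ι) μ = Gj1 x μ) (μ : Fin d) (y : Site d) (ι : Fin d) :
    ‖Gj1 (y + (T' : ℤ) • e ι) μ
        - ∑ r : Fin d → Fin L, ∑ t ∈ Finset.range L, (((L : ℝ) ^ d)⁻¹) •
            conjR (hol Vj ((L : ℤ) • (y + (T' : ℤ) • e ι)) (treeWord (boxVec L r) ++ seg μ (t : ℤ)))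
              (Gj ((L : ℤ) • (y + (T' : ℤ) • e ι) + boxVec L r + (t : ℤ) • e μ) μ)‖ ^ 2
      = ‖Gj1 y μ
        - ∑ r : Fin d → Fin L, ∑ t ∈ Finset.range L, (((L : ℝ) ^ d)⁻¹) •
            conjR (hol Vj ((L : ℤ) • y) (treeWord (boxVec L r) ++ seg μ (t : ℤ)))
              (Gj ((L : ℤ) • y + boxVec L r + (t : ℤ) • e μ) μ)‖ ^ 2 := by
  have hLy : (L : ℤ) • (y + (T' : ℤ) • e ι) = (L : ℤ) • y + (T : ℤ) • e ι := by
    rw [smul_add, smul_smul, hT, Nat.cast_mul]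
  have hhol : ∀ w : List (Letter d), hol Vj ((L : ℤ) • y + (T : ℤ) • e ι) w = hol Vj ((L : ℤ) • y) w := fun w =>
    hol_add_of_periodic Vj ((T : ℤ) • e ι) (fun x μ' => hVj x μ' ι) w _
  have hsum : (∑ r : Fin d → Fin L, ∑ t ∈ Finset.range L, (((L : ℝ) ^ d)⁻¹) •
            conjR (hol Vj ((L : ℤ) • (y + (T' : ℤ) • e ι)) (treeWord (boxVec L r) ++ seg μ (t : ℤ)))
              (Gj ((L : ℤ) • (y + (T' : ℤ) • e ι) + boxVec L r + (t : ℤ) • e μ) μ))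
      = ∑ r : Fin d → Fin L, ∑ t ∈ Finset.range L, (((L : ℝ) ^ d)⁻¹) •
            conjR (hol Vj ((L : ℤ) • y) (treeWord (boxVec L r) ++ seg μ (t : ℤ)))
              (Gj ((L : ℤ) • y + boxVec L r + (t : ℤ) • e μ) μ) := by
    refine Finset.sum_congr rfl fun r _ => Finset.sum_congr rfl fun t _ => ?_
    have hpt : (L : ℤ) • y + (T : ℤ) • e ι + boxVec L r + (t : ℤ) • e μ = ((L : ℤ) • y + boxVec L r + (t : ℤ) • e μ) + (T : ℤ) • e ι := by
      abel
    rw [hLy, hhol, hpt, hGj]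
  rw [hGj1, hsum]

/-! ## §2 ★★★ The cell sum of the per-corner row -/

variable [NeZero N]

/-- ★★★ **Σ OVER CORNERS: THE COVARIANT GRADIENT ENERGY OF THE ACCUMULATED COMB GAUGE FUNCTION OVER ONE PERIOD CELL.**  Tower `V i` of `U1` backgrounds (plaquettes `≤ a i`, two-level
transports `‖V (j+1)(y,ν) − V j([L•y, L•y + L•e_ν])‖ ≤ δ j`), level fields `G i`, accumulated gauge function `Λ` (`Λ 0 = 0`, `Λ (i+1) y = F̂cov (V i) (G i) (L•y) + Λ i (L•y)`),
cube side `L²+L ≤ n+1 ≤ A·L²`, the top loop window `w ≤ 1∕8` and `V̄_{k′}(L•z, κ) ∈ U1` at EVERY cell corner, level periods `Nc i = N′·L^{k′+1−i}` with `V i`, `G i` `Nc i`-periodic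
(`i ≤ k′`).  Then the cell sum `Σ_{z₀ ∈ [0,N′)ᵈ} Σ_κ ‖Λ (k′+1) z − Ad_{V̄_{k′}(L•z,κ)} Λ (k′+1) (z + e_κ)‖²`, `z = boxVec N′ z₀`, is at most ✓F-6c-3d's per-corner right side with every
box functional replaced by its cell total: top pair `L·GRADcell_{k′}`, `d·MASScell_{k′}`; level-`j` cubes `d·d·Aᵈ·GRADcell_j`, `d·d·Aᵈ·MASScell_j`, defect blocks `d·DEFcell_j` (twice: corner
and neighbour); oscillation blocks `d·GRADcell_i`, `d·MASScell_i` (twice) — ✓F-6d-2b `sum_sum_linForm_le` over ✓F-6d-2a's rows.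
[cite: Balaban1985Averaging, (2) p.17, (42)-(47) pp.23-25, (112) p.34, (125)-(126) p.36; Balaban1984PropagatorsI, (1.18)-(1.20) pp.19-20; Balaban1987RG1, (0.1) p.251; Balaban1983RegularityDecay, (2.27) p.580] -/
theorem sum_cell_normSq_covGrad_gauge_le (L : ℕ) (hL : 2 ≤ L) (n A : ℕ) (hn : L * L + L ≤ n + 1) (hnA : n + 1 ≤ A * (L * L))
    (k' N' : ℕ) [NeZero N'] (Nc : ℕ → ℕ) (hNc : ∀ i, i ≤ k' + 1 → Nc i = N' * L ^ (k' + 1 - i))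
    (V : ℕ → Site d → Fin d → (Matrix (Fin N) (Fin N) ℂ)ˣ) (hV : ∀ i x μ, V i x μ ∈ U1 (Matrix (Fin N) (Fin N) ℂ))
    (hVp : ∀ i, i ≤ k' → ∀ (x : Site d) (μ ι : Fin d), V i (x + ((Nc i : ℕ) : ℤ) • e ι) μ = V i x μ)
    (a : ℕ → ℝ) (ha : ∀ i, 0 ≤ a i)
    (hplaq : ∀ i, i ≤ k' → ∀ (x : Site d) (μ ν : Fin d), μ ≠ ν → ‖((hol (V i) x (plaqWord μ ν) : (Matrix (Fin N) (Fin N) ℂ)ˣ) : Matrix (Fin N) (Fin N) ℂ) - 1‖ ≤ a i)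
    (δ : ℕ → ℝ) (hδ : ∀ j, 0 ≤ δ j)
    (hbs : ∀ j, j < k' → ∀ (y : Site d) (ν : Fin d), ‖((V (j + 1) y ν : (Matrix (Fin N) (Fin N) ℂ)ˣ) : Matrix (Fin N) (Fin N) ℂ)
      - ((hol (V j) ((L : ℤ) • y) (seg ν (L : ℤ)) : (Matrix (Fin N) (Fin N) ℂ)ˣ) : Matrix (Fin N) (Fin N) ℂ)‖ ≤ δ j)
    {w : ℝ}
    (hw : ∀ (z₀ : Fin d → Fin N') (κ : Fin d) (r : Fin d → Fin L),
      ‖((Wcx L (V k') ((L : ℤ) • boxVec N' z₀) κ (boxVec L r) : (Matrix (Fin N) (Fin N) ℂ)ˣ) : Matrix (Fin N) (Fin N) ℂ) - 1‖ ≤ w) (hw8 : w ≤ 1 / 8)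
    (hbU : ∀ (z₀ : Fin d → Fin N') (κ : Fin d), bavg L (V k') ((L : ℤ) • boxVec N' z₀) κ ∈ U1 (Matrix (Fin N) (Fin N) ℂ))
    (G : ℕ → Site d → Fin d → Matrix (Fin N) (Fin N) ℂ)
    (hGp : ∀ i, i ≤ k' → ∀ (x : Site d) (μ ι : Fin d), G i (x + ((Nc i : ℕ) : ℤ) • e ι) μ = G i x μ)
    (Λ : ℕ → Site d → Matrix (Fin N) (Fin N) ℂ) (hΛ0 : ∀ y, Λ 0 y = 0)
    (hΛs : ∀ (i : ℕ) (y : Site d), Λ (i + 1) y = FhatCov L (V i) (G i) ((L : ℤ) • y) + Λ i ((L : ℤ) • y)) :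
    ∑ z₀ : Fin d → Fin N', ∑ κ : Fin d,
        ‖Λ (k' + 1) (boxVec N' z₀) - conjR (bavg L (V k') ((L : ℤ) • boxVec N' z₀) κ) (Λ (k' + 1) (boxVec N' z₀ + e κ))‖ ^ 2
      ≤ 3 * ((d : ℝ) * (((L : ℝ) ^ (k' + 1) - 1) / 2) ^ 2 * (((L : ℝ) ^ k')⁻¹ ^ 2 *
              (2 * ((L : ℝ) ^ d)⁻¹ * (L : ℝ) *
                  ((L : ℝ) * ∑ y : Fin d → Fin (Nc k'), ∑ μ : Fin d, ∑ ν : Fin d,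
                    ‖conjR (V k' (boxVec (Nc k') y) ν) (G k' (boxVec (Nc k') y + e ν) μ) - G k' (boxVec (Nc k') y) μ‖ ^ 2)
                + 2 * ((L : ℝ) ^ d)⁻¹ * (8 * (((d : ℝ) + 1) * (L : ℝ)) ^ 2 * a k' + 8 * w) ^ 2 *
                  ((d : ℝ) * ∑ y : Fin d → Fin (Nc k'), ∑ μ : Fin d, ‖G k' (boxVec (Nc k') y) μ‖ ^ 2)))
          + 2 * (d : ℝ) * (1 - (Real.sqrt L)⁻¹)⁻¹
              * ∑ j ∈ range k', (Real.sqrt L) ^ (k' - 1 - j) * (((L : ℝ) ^ (j + 1) - 1) / 2) ^ 2 *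
                (((L : ℝ) ^ j)⁻¹ ^ 2 *
                  (((L : ℝ) ^ d)⁻¹ *
                      (3 * N * ((n : ℝ) + 1) ^ 2 *
                          ((d : ℝ) * ((d : ℝ) * ((A : ℝ) ^ d * ∑ y : Fin d → Fin (Nc j), ∑ μ : Fin d, ∑ ν : Fin d,
                            ‖conjR (V j (boxVec (Nc j) y) ν) (G j (boxVec (Nc j) y + e ν) μ) - G j (boxVec (Nc j) y) μ‖ ^ 2)))
                        + (12 * N * ((n : ℝ) + 1) ^ 2 * (d : ℝ) ^ 3 * (n : ℝ) ^ 2 * a j ^ 2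
                            + 3 * (2 * d * L * δ j + 2 * ((3 * d + 1) * n : ℝ) ^ 2 * a j) ^ 2) *
                          ((d : ℝ) * ((d : ℝ) * ((A : ℝ) ^ d * ∑ y : Fin d → Fin (Nc j), ∑ μ : Fin d, ‖G j (boxVec (Nc j) y) μ‖ ^ 2))))
                    + 3 * ((L : ℝ) ^ 2)⁻¹ * ((L : ℝ) ^ d)⁻¹ *
                      ((d : ℝ) * ∑ μ : Fin d, ∑ y : Fin d → Fin (Nc (j + 1)),
                        ‖G (j + 1) (boxVec (Nc (j + 1)) y) μ
                          - ∑ r : Fin d → Fin L, ∑ t ∈ Finset.range L, (((L : ℝ) ^ d)⁻¹) •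
                              conjR (hol (V j) ((L : ℤ) • boxVec (Nc (j + 1)) y) (treeWord (boxVec L r) ++ seg μ (t : ℤ)))
                                (G j ((L : ℤ) • boxVec (Nc (j + 1)) y + boxVec L r + (t : ℤ) • e μ) μ)‖ ^ 2))
                + ((L : ℝ) ^ j)⁻¹ ^ 2 *
                  (((L : ℝ) ^ d)⁻¹ *
                      (3 * N * ((n : ℝ) + 1) ^ 2 *
                          ((d : ℝ) * ((d : ℝ) * ((A : ℝ) ^ d * ∑ y : Fin d → Fin (Nc j), ∑ μ : Fin d, ∑ ν : Fin d,
                            ‖conjR (V j (boxVec (Nc j) y) ν) (G j (boxVec (Nc j) y + e ν) μ) - G j (boxVec (Nc j) y) μ‖ ^ 2)))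
                        + (12 * N * ((n : ℝ) + 1) ^ 2 * (d : ℝ) ^ 3 * (n : ℝ) ^ 2 * a j ^ 2
                            + 3 * (2 * d * L * δ j + 2 * ((3 * d + 1) * n : ℝ) ^ 2 * a j) ^ 2) *
                          ((d : ℝ) * ((d : ℝ) * ((A : ℝ) ^ d * ∑ y : Fin d → Fin (Nc j), ∑ μ : Fin d, ‖G j (boxVec (Nc j) y) μ‖ ^ 2))))
                    + 3 * ((L : ℝ) ^ 2)⁻¹ * ((L : ℝ) ^ d)⁻¹ *
                      ((d : ℝ) * ∑ μ : Fin d, ∑ y : Fin d → Fin (Nc (j + 1)),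
                        ‖G (j + 1) (boxVec (Nc (j + 1)) y) μ
                          - ∑ r : Fin d → Fin L, ∑ t ∈ Finset.range L, (((L : ℝ) ^ d)⁻¹) •
                              conjR (hol (V j) ((L : ℤ) • boxVec (Nc (j + 1)) y) (treeWord (boxVec L r) ++ seg μ (t : ℤ)))
                                (G j ((L : ℤ) • boxVec (Nc (j + 1)) y + boxVec L r + (t : ℤ) • e μ) μ)‖ ^ 2)))
          + 2 * (1 - (Real.sqrt L)⁻¹)⁻¹ * ∑ i ∈ range (k' + 1), (Real.sqrt L) ^ (k' - i) *
              ((N / 2 * (d : ℝ) ^ 2 * ((L : ℝ) - 1) ^ 2 * (L : ℝ) ^ 2 *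
                  ((d : ℝ) * ∑ y : Fin d → Fin (Nc i), ∑ μ : Fin d, ∑ ν : Fin d,
                    ‖conjR (V i (boxVec (Nc i) y) ν) (G i (boxVec (Nc i) y + e ν) μ) - G i (boxVec (Nc i) y) μ‖ ^ 2)
                + (8 * (d : ℝ) ^ 6 * ((L : ℝ) - 1) ^ 6 + 2 * N * (d : ℝ) ^ 5 * ((L : ℝ) - 1) ^ 4 * (L : ℝ) ^ 2) * a i ^ 2 *
                  ((d : ℝ) * ∑ y : Fin d → Fin (Nc i), ∑ μ : Fin d, ‖G i (boxVec (Nc i) y) μ‖ ^ 2))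
              + (N / 2 * (d : ℝ) ^ 2 * ((L : ℝ) - 1) ^ 2 * (L : ℝ) ^ 2 *
                  ((d : ℝ) * ∑ y : Fin d → Fin (Nc i), ∑ μ : Fin d, ∑ ν : Fin d,
                    ‖conjR (V i (boxVec (Nc i) y) ν) (G i (boxVec (Nc i) y + e ν) μ) - G i (boxVec (Nc i) y) μ‖ ^ 2)
                + (8 * (d : ℝ) ^ 6 * ((L : ℝ) - 1) ^ 6 + 2 * N * (d : ℝ) ^ 5 * ((L : ℝ) - 1) ^ 4 * (L : ℝ) ^ 2) * a i ^ 2 *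
                  ((d : ℝ) * ∑ y : Fin d → Fin (Nc i), ∑ μ : Fin d, ‖G i (boxVec (Nc i) y) μ‖ ^ 2)))) := by
  have hL1 : 1 ≤ L := by omega
  have hL0 : (0 : ℝ) < L := by exact_mod_cast (show 0 < L by omega)
  -- the per-corner row at every cell corner
  have hpt := fun (z₀ : Fin d → Fin N') (κ : Fin d) =>
    normSq_covGrad_gauge_le_of_stepMean L hL n hn k' V hV a ha hplaq δ hδ hbs (boxVec N' z₀) κ (hw z₀ κ) hw8 (hbU z₀ κ) G Λ hΛ0 hΛs
  -- level bookkeeping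
  have hNk' : Nc k' = N' * L := by rw [hNc k' (by omega), show k' + 1 - k' = 1 by omega, pow_one]
  have hp2 : ∀ j, j < k' → n + 1 ≤ A * L ^ (k' + 1 - j) := by
    intro j hj
    refine hnA.trans (Nat.mul_le_mul_left _ ?_)
    rw [← pow_two]
    exact Nat.pow_le_pow_right (by omega) (by omega)
  have hp1 : ∀ i, i < k' + 1 → L ≤ 1 * L ^ (k' + 1 - i) := by
    intro i hi
    rw [one_mul]
    calc L = L ^ 1 := (pow_one L).symm
      _ ≤ L ^ (k' + 1 - i) := Nat.pow_le_pow_right (by omega) (by omega)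
  have hp1' : ∀ j, j < k' → L ≤ 1 * L ^ (k' - j) := by
    intro j hj
    rw [one_mul]
    calc L = L ^ 1 := (pow_one L).symm
      _ ≤ L ^ (k' - j) := Nat.pow_le_pow_right (by omega) (by omega)
  have hNcs : ∀ j, j < k' → Nc (j + 1) = N' * L ^ (k' - j) := by
    intro j hj; rw [hNc (j + 1) (by omega), show k' + 1 - (j + 1) = k' - j by omega]
  have hNcT : ∀ j, j < k' → Nc j = L * Nc (j + 1) := by
    intro j hj
    rw [hNc j (by omega), hNcs j hj, show k' + 1 - j = (k' - j) + 1 by omega, pow_succ]; ring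
  -- periodicity of the densities
  have hgradp : ∀ i, i ≤ k' → ∀ (ν μ : Fin d) (y : Site d) (ι : Fin d),
      ‖conjR (V i (y + ((Nc i : ℕ) : ℤ) • e ι) ν) (G i (y + ((Nc i : ℕ) : ℤ) • e ι + e ν) μ) - G i (y + ((Nc i : ℕ) : ℤ) • e ι) μ‖ ^ 2
        = ‖conjR (V i y ν) (G i (y + e ν) μ) - G i y μ‖ ^ 2 := by
    intro i hi ν μ y ι
    rw [hVp i hi, add_right_comm, hGp i hi, hGp i hi]
  have hmassp : ∀ i, i ≤ k' → ∀ (μ : Fin d) (y : Site d) (ι : Fin d),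
      ‖G i (y + ((Nc i : ℕ) : ℤ) • e ι) μ‖ ^ 2 = ‖G i y μ‖ ^ 2 := by
    intro i hi μ y ι; rw [hGp i hi]
  have hdefp : ∀ j, j < k' → ∀ (μ : Fin d) (y : Site d) (ι : Fin d),
      ‖G (j + 1) (y + ((Nc (j + 1) : ℕ) : ℤ) • e ι) μ
          - ∑ r : Fin d → Fin L, ∑ t ∈ Finset.range L, (((L : ℝ) ^ d)⁻¹) •
              conjR (hol (V j) ((L : ℤ) • (y + ((Nc (j + 1) : ℕ) : ℤ) • e ι)) (treeWord (boxVec L r) ++ seg μ (t : ℤ)))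
                (G j ((L : ℤ) • (y + ((Nc (j + 1) : ℕ) : ℤ) • e ι) + boxVec L r + (t : ℤ) • e μ) μ)‖ ^ 2
        = ‖G (j + 1) y μ
          - ∑ r : Fin d → Fin L, ∑ t ∈ Finset.range L, (((L : ℝ) ^ d)⁻¹) •
              conjR (hol (V j) ((L : ℤ) • y) (treeWord (boxVec L r) ++ seg μ (t : ℤ)))
                (G j ((L : ℤ) • y + boxVec L r + (t : ℤ) • e μ) μ)‖ ^ 2 := by
    intro j hj μ y ι
    exact defDensity_periodic L (Nc j) (Nc (j + 1)) (hNcT j hj) (V j) (G j) (G (j + 1)) (hVp j hj.le) (hGp j hj.le) (hGp (j + 1) (by omega)) μ y ι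
  -- nonnegativity of the coefficients
  have hsqrt1 : 1 < Real.sqrt L := by
    rw [show (1 : ℝ) = Real.sqrt 1 from Real.sqrt_one.symm]
    exact Real.sqrt_lt_sqrt (by norm_num) (by exact_mod_cast hL)
  have hcL : 0 ≤ (1 - (Real.sqrt (L : ℝ))⁻¹)⁻¹ := by
    have : (Real.sqrt (L : ℝ))⁻¹ < 1 := inv_lt_one_of_one_lt₀ hsqrt1
    exact inv_nonneg.2 (by linarith)
  have hsq0 : 0 ≤ Real.sqrt (L : ℝ) := Real.sqrt_nonneg _
  -- the per-corner rows summed, then the abstract knit ✓F-6d-2b over the twelve totals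
  refine le_trans (Finset.sum_le_sum fun z₀ _ => Finset.sum_le_sum fun κ _ => hpt z₀ κ) (sum_sum_linForm_le (Z := Fin d → Fin N') (K := Fin d) k'
    (dd := (d : ℝ)) (Wt := (((L : ℝ) ^ (k' + 1) - 1) / 2) ^ 2) (c₁ := ((L : ℝ) ^ k')⁻¹ ^ 2) (c₂ := 2 * ((L : ℝ) ^ d)⁻¹ * (L : ℝ))
    (c₃ := 2 * ((L : ℝ) ^ d)⁻¹ * (8 * (((d : ℝ) + 1) * (L : ℝ)) ^ 2 * a k' + 8 * w) ^ 2) (cL := (1 - (Real.sqrt L)⁻¹)⁻¹)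
    (Ld := ((L : ℝ) ^ d)⁻¹) (cg := 3 * N * ((n : ℝ) + 1) ^ 2) (cd := 3 * ((L : ℝ) ^ 2)⁻¹ * ((L : ℝ) ^ d)⁻¹)
    (cO := N / 2 * (d : ℝ) ^ 2 * ((L : ℝ) - 1) ^ 2 * (L : ℝ) ^ 2)
    (sw := fun j => (Real.sqrt L) ^ (k' - 1 - j)) (w := fun j => (((L : ℝ) ^ (j + 1) - 1) / 2) ^ 2) (c1 := fun j => ((L : ℝ) ^ j)⁻¹ ^ 2)
    (Cm := fun j => 12 * N * ((n : ℝ) + 1) ^ 2 * (d : ℝ) ^ 3 * (n : ℝ) ^ 2 * a j ^ 2 + 3 * (2 * d * L * δ j + 2 * ((3 * d + 1) * n : ℝ) ^ 2 * a j) ^ 2)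
    (so := fun i => (Real.sqrt L) ^ (k' - i))
    (cO' := fun i => (8 * (d : ℝ) ^ 6 * ((L : ℝ) - 1) ^ 6 + 2 * N * (d : ℝ) ^ 5 * ((L : ℝ) - 1) ^ 4 * (L : ℝ) ^ 2) * a i ^ 2)
    (Nat.cast_nonneg d) (sq_nonneg _) (sq_nonneg _) (by positivity) (by positivity) hcL (by positivity) (by positivity) (by positivity)
    (by positivity) (fun j => pow_nonneg hsq0 _) (fun j => sq_nonneg _) (fun j => sq_nonneg _) (fun j => by positivity) (fun i => pow_nonneg hsq0 _)
    (fun i => by positivity)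
    -- the twelve atoms
    (Tg := fun z₀ κ μ => ∑ s : Fin d → Fin L, ∑ t ∈ range L,
      ‖conjR (V k' ((L : ℤ) • boxVec N' z₀ + boxVec L s + (t : ℤ) • e κ) κ) (G k' ((L : ℤ) • boxVec N' z₀ + boxVec L s + (t : ℤ) • e κ + e κ) μ)
        - G k' ((L : ℤ) • boxVec N' z₀ + boxVec L s + (t : ℤ) • e κ) μ‖ ^ 2)
    (Tm := fun z₀ κ μ => ∑ s : Fin d → Fin L, ‖G k' ((L : ℤ) • boxVec N' z₀ + (L : ℤ) • e κ + boxVec L s) μ‖ ^ 2)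
    (Eg := fun j z₀ κ μ => ∑ μ' : Fin d, ∑ ν : Fin d, ∑ ρ ∈ univ.filter (fun ρ : Fin d → Fin (n + 1) => ρ ν ≠ Fin.last n),
      ‖conjR (V j (((L : ℤ) ^ (k' + 1 - j)) • boxVec N' z₀ + boxVec (n + 1) ρ) ν) (G j (((L : ℤ) ^ (k' + 1 - j)) • boxVec N' z₀ + boxVec (n + 1) ρ + e ν) μ')
        - G j (((L : ℤ) ^ (k' + 1 - j)) • boxVec N' z₀ + boxVec (n + 1) ρ) μ'‖ ^ 2)
    (Em := fun j z₀ κ μ => ∑ μ' : Fin d, ∑ ρ : Fin d → Fin (n + 1), ‖G j (((L : ℤ) ^ (k' + 1 - j)) • boxVec N' z₀ + boxVec (n + 1) ρ) μ'‖ ^ 2)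
    (Ed := fun j z₀ κ μ => ∑ s' : Fin d → Fin L,
      ‖G (j + 1) (((L : ℤ) ^ (k' - j)) • boxVec N' z₀ + boxVec L s') μ
        - ∑ r : Fin d → Fin L, ∑ t ∈ Finset.range L, (((L : ℝ) ^ d)⁻¹) •
            conjR (hol (V j) ((L : ℤ) • (((L : ℤ) ^ (k' - j)) • boxVec N' z₀ + boxVec L s')) (treeWord (boxVec L r) ++ seg μ (t : ℤ)))
              (G j ((L : ℤ) • (((L : ℤ) ^ (k' - j)) • boxVec N' z₀ + boxVec L s') + boxVec L r + (t : ℤ) • e μ) μ)‖ ^ 2)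
    (Eg' := fun j z₀ κ μ => ∑ μ' : Fin d, ∑ ν : Fin d, ∑ ρ ∈ univ.filter (fun ρ : Fin d → Fin (n + 1) => ρ ν ≠ Fin.last n),
      ‖conjR (V j (((L : ℤ) ^ (k' + 1 - j)) • (boxVec N' z₀ + e κ) + boxVec (n + 1) ρ) ν) (G j (((L : ℤ) ^ (k' + 1 - j)) • (boxVec N' z₀ + e κ) + boxVec (n + 1) ρ + e ν) μ')
        - G j (((L : ℤ) ^ (k' + 1 - j)) • (boxVec N' z₀ + e κ) + boxVec (n + 1) ρ) μ'‖ ^ 2)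
    (Em' := fun j z₀ κ μ => ∑ μ' : Fin d, ∑ ρ : Fin d → Fin (n + 1), ‖G j (((L : ℤ) ^ (k' + 1 - j)) • (boxVec N' z₀ + e κ) + boxVec (n + 1) ρ) μ'‖ ^ 2)
    (Ed' := fun j z₀ κ μ => ∑ s' : Fin d → Fin L,
      ‖G (j + 1) (((L : ℤ) ^ (k' - j)) • (boxVec N' z₀ + e κ) + boxVec L s') μ
        - ∑ r : Fin d → Fin L, ∑ t ∈ Finset.range L, (((L : ℝ) ^ d)⁻¹) •
            conjR (hol (V j) ((L : ℤ) • (((L : ℤ) ^ (k' - j)) • (boxVec N' z₀ + e κ) + boxVec L s')) (treeWord (boxVec L r) ++ seg μ (t : ℤ)))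
              (G j ((L : ℤ) • (((L : ℤ) ^ (k' - j)) • (boxVec N' z₀ + e κ) + boxVec L s') + boxVec L r + (t : ℤ) • e μ) μ)‖ ^ 2)
    (Og := fun i z₀ κ => ∑ μ : Fin d, ∑ ν : Fin d, ∑ s ∈ univ.filter (fun s : Fin d → Fin L => (s ν : ℕ) + 1 ≠ L),
      ‖conjR (V i (((L : ℤ) ^ (k' + 1 - i)) • boxVec N' z₀ + boxVec L s) ν) (G i (((L : ℤ) ^ (k' + 1 - i)) • boxVec N' z₀ + boxVec L s + e ν) μ)
        - G i (((L : ℤ) ^ (k' + 1 - i)) • boxVec N' z₀ + boxVec L s) μ‖ ^ 2)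
    (Om := fun i z₀ κ => ∑ s : Fin d → Fin L, ∑ μ : Fin d, ‖G i (((L : ℤ) ^ (k' + 1 - i)) • boxVec N' z₀ + boxVec L s) μ‖ ^ 2)
    (Og' := fun i z₀ κ => ∑ μ : Fin d, ∑ ν : Fin d, ∑ s ∈ univ.filter (fun s : Fin d → Fin L => (s ν : ℕ) + 1 ≠ L),
      ‖conjR (V i (((L : ℤ) ^ (k' + 1 - i)) • (boxVec N' z₀ + e κ) + boxVec L s) ν) (G i (((L : ℤ) ^ (k' + 1 - i)) • (boxVec N' z₀ + e κ) + boxVec L s + e ν) μ)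
        - G i (((L : ℤ) ^ (k' + 1 - i)) • (boxVec N' z₀ + e κ) + boxVec L s) μ‖ ^ 2)
    (Om' := fun i z₀ κ => ∑ s : Fin d → Fin L, ∑ μ : Fin d, ‖G i (((L : ℤ) ^ (k' + 1 - i)) • (boxVec N' z₀ + e κ) + boxVec L s) μ‖ ^ 2)
    -- the twelve totals (F-6d-2a)
    (hTg := le_of_eq (sum_cell_top_grad_eq N' L hL1 (Nc k') hNk'
      (fun κ μ y => ‖conjR (V k' y κ) (G k' (y + e κ) μ) - G k' y μ‖ ^ 2) (fun κ μ y ν => hgradp k' le_rfl κ μ y ν)))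
    (hTm := le_of_eq (sum_cell_top_mass_eq N' L hL1 (Nc k') hNk' (fun μ y => ‖G k' y μ‖ ^ 2) (fun μ y ν => hmassp k' le_rfl μ y ν)))
    (hEg := fun j hj => ?_) (hEm := fun j hj => ?_) (hEd := fun j hj => ?_)
    (hEg' := fun j hj => ?_) (hEm' := fun j hj => ?_) (hEd' := fun j hj => ?_)
    (hOg := fun i hi => ?_) (hOm := fun i hi => ?_) (hOg' := fun i hi => ?_) (hOm' := fun i hi => ?_))
  -- (Eg) cube gradients at the corner chain: `Σ_κ Σ_μ` of a constant, then ✓F-6d-2a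
  · have h := sum_cell_cube_grad_le N' L (k' + 1 - j) (n + 1) A hL1 (hp2 j hj) (Nc j) (hNc j (by omega))
      (fun ν μ' y => ‖conjR (V j y ν) (G j (y + e ν) μ') - G j y μ'‖ ^ 2) (fun _ _ _ => sq_nonneg _) (fun ν μ' y ι => hgradp j hj.le ν μ' y ι)
      (fun ν (ρ : Fin d → Fin (n + 1)) => ρ ν ≠ Fin.last n)
    simp only [Finset.sum_const, Finset.card_univ, Fintype.card_fin, nsmul_eq_mul]
    rw [← Finset.mul_sum, ← Finset.mul_sum]
    exact mul_le_mul_of_nonneg_left (mul_le_mul_of_nonneg_left h (Nat.cast_nonneg d)) (Nat.cast_nonneg d)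
  · have h := sum_cell_cube_mass_le N' L (k' + 1 - j) (n + 1) A hL1 (hp2 j hj) (Nc j) (hNc j (by omega))
      (fun μ' y => ‖G j y μ'‖ ^ 2) (fun _ _ => sq_nonneg _) (fun μ' y ι => hmassp j hj.le μ' y ι)
    simp only [Finset.sum_const, Finset.card_univ, Fintype.card_fin, nsmul_eq_mul]
    rw [← Finset.mul_sum, ← Finset.mul_sum]
    exact mul_le_mul_of_nonneg_left (mul_le_mul_of_nonneg_left h (Nat.cast_nonneg d)) (Nat.cast_nonneg d)
  · -- (Ed) defect blocks: `Σ_κ` of a κ-constant, `Σ_μ` carried, multiplicity one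
    have h : ∀ μ : Fin d, ∑ z₀ : Fin d → Fin N', ∑ s' : Fin d → Fin L,
        ‖G (j + 1) (((L : ℤ) ^ (k' - j)) • boxVec N' z₀ + boxVec L s') μ
          - ∑ r : Fin d → Fin L, ∑ t ∈ Finset.range L, (((L : ℝ) ^ d)⁻¹) •
              conjR (hol (V j) ((L : ℤ) • (((L : ℤ) ^ (k' - j)) • boxVec N' z₀ + boxVec L s')) (treeWord (boxVec L r) ++ seg μ (t : ℤ)))
                (G j ((L : ℤ) • (((L : ℤ) ^ (k' - j)) • boxVec N' z₀ + boxVec L s') + boxVec L r + (t : ℤ) • e μ) μ)‖ ^ 2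
        ≤ ∑ y : Fin d → Fin (Nc (j + 1)),
            ‖G (j + 1) (boxVec (Nc (j + 1)) y) μ
              - ∑ r : Fin d → Fin L, ∑ t ∈ Finset.range L, (((L : ℝ) ^ d)⁻¹) •
                  conjR (hol (V j) ((L : ℤ) • boxVec (Nc (j + 1)) y) (treeWord (boxVec L r) ++ seg μ (t : ℤ)))
                    (G j ((L : ℤ) • boxVec (Nc (j + 1)) y + boxVec L r + (t : ℤ) • e μ) μ)‖ ^ 2 := by
      intro μ
      have h1 := sum_cell_box_fun_le N' L (k' - j) L 1 hL1 (hp1' j hj) (Nc (j + 1)) (hNcs j hj)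
        (fun y => ‖G (j + 1) y μ
          - ∑ r : Fin d → Fin L, ∑ t ∈ Finset.range L, (((L : ℝ) ^ d)⁻¹) •
              conjR (hol (V j) ((L : ℤ) • y) (treeWord (boxVec L r) ++ seg μ (t : ℤ))) (G j ((L : ℤ) • y + boxVec L r + (t : ℤ) • e μ) μ)‖ ^ 2)
        (fun _ => sq_nonneg _) (fun y ι => hdefp j hj μ y ι)
      simpa only [Nat.cast_one, one_pow, one_mul] using h1
    simp only [Finset.sum_const, Finset.card_univ, Fintype.card_fin, nsmul_eq_mul]
    rw [← Finset.mul_sum, Finset.sum_comm]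
    exact mul_le_mul_of_nonneg_left (Finset.sum_le_sum fun μ _ => h μ) (Nat.cast_nonneg d)
  · -- (Eg′) the neighbour's cubes: per `κ` the shifted row, then `Σ_κ` of the constant bound
    have h : ∀ κ : Fin d, ∑ z₀ : Fin d → Fin N', ∑ μ' : Fin d, ∑ ν : Fin d, ∑ ρ ∈ univ.filter (fun ρ : Fin d → Fin (n + 1) => ρ ν ≠ Fin.last n),
        ‖conjR (V j (((L : ℤ) ^ (k' + 1 - j)) • (boxVec N' z₀ + e κ) + boxVec (n + 1) ρ) ν) (G j (((L : ℤ) ^ (k' + 1 - j)) • (boxVec N' z₀ + e κ) + boxVec (n + 1) ρ + e ν) μ')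
          - G j (((L : ℤ) ^ (k' + 1 - j)) • (boxVec N' z₀ + e κ) + boxVec (n + 1) ρ) μ'‖ ^ 2
        ≤ (A : ℝ) ^ d * ∑ y : Fin d → Fin (Nc j), ∑ μ : Fin d, ∑ ν : Fin d,
            ‖conjR (V j (boxVec (Nc j) y) ν) (G j (boxVec (Nc j) y + e ν) μ) - G j (boxVec (Nc j) y) μ‖ ^ 2 := fun κ =>
      sum_cell_cube_grad_shift_le N' L (k' + 1 - j) (n + 1) A hL1 (hp2 j hj) (Nc j) (hNc j (by omega))
        (fun ν μ' y => ‖conjR (V j y ν) (G j (y + e ν) μ') - G j y μ'‖ ^ 2) (fun _ _ _ => sq_nonneg _) (fun ν μ' y ι => hgradp j hj.le ν μ' y ι)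
        (fun ν (ρ : Fin d → Fin (n + 1)) => ρ ν ≠ Fin.last n) (e κ)
    simp only [Finset.sum_const, Finset.card_univ, Fintype.card_fin, nsmul_eq_mul]
    rw [Finset.sum_comm]
    calc ∑ κ : Fin d, ∑ z₀ : Fin d → Fin N', (d : ℝ) * _ = (d : ℝ) * ∑ κ : Fin d, ∑ z₀ : Fin d → Fin N', _ := by
          rw [Finset.mul_sum]; exact Finset.sum_congr rfl fun κ _ => by rw [Finset.mul_sum]
      _ ≤ (d : ℝ) * ∑ κ : Fin d, ((A : ℝ) ^ d * _) := mul_le_mul_of_nonneg_left (Finset.sum_le_sum fun κ _ => h κ) (Nat.cast_nonneg d)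
      _ = _ := by rw [Finset.sum_const, Finset.card_univ, Fintype.card_fin, nsmul_eq_mul]
  · have h : ∀ κ : Fin d, ∑ z₀ : Fin d → Fin N', ∑ μ' : Fin d, ∑ ρ : Fin d → Fin (n + 1),
        ‖G j (((L : ℤ) ^ (k' + 1 - j)) • (boxVec N' z₀ + e κ) + boxVec (n + 1) ρ) μ'‖ ^ 2
        ≤ (A : ℝ) ^ d * ∑ y : Fin d → Fin (Nc j), ∑ μ : Fin d, ‖G j (boxVec (Nc j) y) μ‖ ^ 2 := fun κ =>
      sum_cell_cube_mass_shift_le N' L (k' + 1 - j) (n + 1) A hL1 (hp2 j hj) (Nc j) (hNc j (by omega))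
        (fun μ' y => ‖G j y μ'‖ ^ 2) (fun _ _ => sq_nonneg _) (fun μ' y ι => hmassp j hj.le μ' y ι) (e κ)
    simp only [Finset.sum_const, Finset.card_univ, Fintype.card_fin, nsmul_eq_mul]
    rw [Finset.sum_comm]
    calc ∑ κ : Fin d, ∑ z₀ : Fin d → Fin N', (d : ℝ) * _ = (d : ℝ) * ∑ κ : Fin d, ∑ z₀ : Fin d → Fin N', _ := by
          rw [Finset.mul_sum]; exact Finset.sum_congr rfl fun κ _ => by rw [Finset.mul_sum]
      _ ≤ (d : ℝ) * ∑ κ : Fin d, ((A : ℝ) ^ d * _) := mul_le_mul_of_nonneg_left (Finset.sum_le_sum fun κ _ => h κ) (Nat.cast_nonneg d)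
      _ = _ := by rw [Finset.sum_const, Finset.card_univ, Fintype.card_fin, nsmul_eq_mul]
  · -- (Ed′) the neighbour's defect blocks
    have h : ∀ (κ μ : Fin d), ∑ z₀ : Fin d → Fin N', ∑ s' : Fin d → Fin L,
        ‖G (j + 1) (((L : ℤ) ^ (k' - j)) • (boxVec N' z₀ + e κ) + boxVec L s') μ
          - ∑ r : Fin d → Fin L, ∑ t ∈ Finset.range L, (((L : ℝ) ^ d)⁻¹) •
              conjR (hol (V j) ((L : ℤ) • (((L : ℤ) ^ (k' - j)) • (boxVec N' z₀ + e κ) + boxVec L s')) (treeWord (boxVec L r) ++ seg μ (t : ℤ)))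
                (G j ((L : ℤ) • (((L : ℤ) ^ (k' - j)) • (boxVec N' z₀ + e κ) + boxVec L s') + boxVec L r + (t : ℤ) • e μ) μ)‖ ^ 2
        ≤ ∑ y : Fin d → Fin (Nc (j + 1)),
            ‖G (j + 1) (boxVec (Nc (j + 1)) y) μ
              - ∑ r : Fin d → Fin L, ∑ t ∈ Finset.range L, (((L : ℝ) ^ d)⁻¹) •
                  conjR (hol (V j) ((L : ℤ) • boxVec (Nc (j + 1)) y) (treeWord (boxVec L r) ++ seg μ (t : ℤ)))
                    (G j ((L : ℤ) • boxVec (Nc (j + 1)) y + boxVec L r + (t : ℤ) • e μ) μ)‖ ^ 2 := by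
      intro κ μ
      have h1 := sum_cell_box_fun_shift_le N' L (k' - j) L 1 hL1 (hp1' j hj) (Nc (j + 1)) (hNcs j hj)
        (fun y => ‖G (j + 1) y μ
          - ∑ r : Fin d → Fin L, ∑ t ∈ Finset.range L, (((L : ℝ) ^ d)⁻¹) •
              conjR (hol (V j) ((L : ℤ) • y) (treeWord (boxVec L r) ++ seg μ (t : ℤ))) (G j ((L : ℤ) • y + boxVec L r + (t : ℤ) • e μ) μ)‖ ^ 2)
        (fun _ => sq_nonneg _) (fun y ι => hdefp j hj μ y ι) (e κ)
      simpa only [Nat.cast_one, one_pow, one_mul] using h1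
    calc _ = ∑ κ : Fin d, ∑ μ : Fin d, ∑ z₀ : Fin d → Fin N', _ := by
          rw [Finset.sum_comm]; exact Finset.sum_congr rfl fun κ _ => Finset.sum_comm
      _ ≤ ∑ κ : Fin d, ∑ μ : Fin d, ∑ y : Fin d → Fin (Nc (j + 1)), _ := Finset.sum_le_sum fun κ _ => Finset.sum_le_sum fun μ _ => h κ μ
      _ = _ := by rw [Finset.sum_const, Finset.card_univ, Fintype.card_fin, nsmul_eq_mul]
  · -- (Og) oscillation gradients at the corner chain (multiplicity one)
    have h := sum_cell_cube_grad_le N' L (k' + 1 - i) L 1 hL1 (hp1 i hi) (Nc i) (hNc i (by omega))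
      (fun ν μ y => ‖conjR (V i y ν) (G i (y + e ν) μ) - G i y μ‖ ^ 2) (fun _ _ _ => sq_nonneg _) (fun ν μ y ι => hgradp i (by omega) ν μ y ι)
      (fun ν (s : Fin d → Fin L) => (s ν : ℕ) + 1 ≠ L)
    simp only [Finset.sum_const, Finset.card_univ, Fintype.card_fin, nsmul_eq_mul, Nat.cast_one, one_pow, one_mul] at h ⊢
    rw [← Finset.mul_sum]
    exact mul_le_mul_of_nonneg_left h (Nat.cast_nonneg d)
  · have h := sum_cell_block_mass_le' N' L (k' + 1 - i) L 1 hL1 (hp1 i hi) (Nc i) (hNc i (by omega))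
      (fun μ y => ‖G i y μ‖ ^ 2) (fun _ _ => sq_nonneg _) (fun μ y ι => hmassp i (by omega) μ y ι)
    simp only [Finset.sum_const, Finset.card_univ, Fintype.card_fin, nsmul_eq_mul, Nat.cast_one, one_pow, one_mul] at h ⊢
    rw [← Finset.mul_sum]
    exact mul_le_mul_of_nonneg_left h (Nat.cast_nonneg d)
  · -- (Og′) the neighbour's oscillation gradients
    have h := fun κ : Fin d =>
      sum_cell_cube_grad_shift_le N' L (k' + 1 - i) L 1 hL1 (hp1 i hi) (Nc i) (hNc i (by omega))
        (fun ν μ y => ‖conjR (V i y ν) (G i (y + e ν) μ) - G i y μ‖ ^ 2) (fun _ _ _ => sq_nonneg _) (fun ν μ y ι => hgradp i (by omega) ν μ y ι)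
        (fun ν (s : Fin d → Fin L) => (s ν : ℕ) + 1 ≠ L) (e κ)
    simp only [Nat.cast_one, one_pow, one_mul] at h
    rw [Finset.sum_comm]
    calc _ ≤ ∑ κ : Fin d, _ := Finset.sum_le_sum fun κ _ => h κ
      _ = _ := by rw [Finset.sum_const, Finset.card_univ, Fintype.card_fin, nsmul_eq_mul]
  · have h := fun κ : Fin d =>
      sum_cell_block_mass_shift_le' N' L (k' + 1 - i) L 1 hL1 (hp1 i hi) (Nc i) (hNc i (by omega))
        (fun μ y => ‖G i y μ‖ ^ 2) (fun _ _ => sq_nonneg _) (fun μ y ι => hmassp i (by omega) μ y ι) (e κ)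
    simp only [Nat.cast_one, one_pow, one_mul] at h
    rw [Finset.sum_comm]
    calc _ ≤ ∑ κ : Fin d, _ := Finset.sum_le_sum fun κ _ => h κ
      _ = _ := by rw [Finset.sum_const, Finset.card_univ, Fintype.card_fin, nsmul_eq_mul]

end Summit.QuantumFields.YangMills.Theorems.Prop7CornerCombCellKnit

end
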